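import Mathlib
import HarnessLib
import HarnessLib.Audit
import Summits.PneNP.Statement
import Literature.Computability.Complexity.Randomized
import Literature.Computability.Complexity.BoolEncodings
import Literature.Computability.Complexity.Classes
import Literature.Computability.Complexity.Reductions
import HarnessLib.Audit.Status.Attr

/-!
Route: Kloosterman

DORMANT since 2026-08-22T18:54:24Z (reconciler: no traction for 5.6 d (last activity item-evidence-added at 2026-08-17T04:27:20Z); parked, not closed — `ledger route dormant route-PneNP-Kloosterman --off` to reactivate) — unstaffed, not closed; items shared with open routes are served there. `ledger route dormant <id> --off` reactivates.

# Route Kloosterman — small square roots modulo a product of many known random primes are hard to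
find on average (Kloosterman knapsacks)

It suffices to show X = PlantedRootHardness (realises card
PneNP/PneNP/kloosterman-knapsacks-quadratic-congruences): the PLANTED SMALL-ROOT
problem is weakly hard on average. Ensemble D_m: S a uniformly random m-subset of the primes of
bit-length 3*floor(log2 m)+3, b = prod S
(squarefree, factorisation public), x uniform in [0, c) with c = floor(b/2^m) (density one: about
one root below c besides the planted pair),
a = x^2 mod b; the solver gets (sorted S, a, c) and must output ANY z < c with z^2 = a (mod b). X
says: one polynomial q serves all
probabilistic polynomial-time solvers B — eventually in m, B's success probability over D_m and its
coins is at most 1 - 1/q(m)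
(Goldreich's weak one-wayness, Def. 2.2.2, stated at problem level over
Literature.Computability.Complexity.RandAlg). Equivalently: the
modular knapsack "find signs s in (+-1)^S with sum_p s_p r_p e_p mod b in [0,c)" (r_p = sqrt(a) mod
p, e_p the CRT idempotents), whose weights
(b/p)*t_p are Kloosterman-type fractions t_p/p = x*inv(b/p)/p mod 1, is hard at density one.
Lean: `∃ q : Polynomial ℕ, (∀ n, 0 < q.eval n) ∧ ∀ B : Literature.Computability.Complexity.RandAlg
(List Bool) (List Bool), B.IsPolyTime (id : List Bool → List Bool) (id : List Bool → List Bool) → ∀ᶠ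
m : ℕ in Filter.atTop, let fam : Finset (Finset ℕ) := ((Finset.Ico (2 ^ (3 * Nat.log 2 m + 2)) (2 ^
(3 * Nat.log 2 m + 3))).filter Nat.Prime).powersetCard m; (∑ S ∈ fam, (∑ x ∈ Finset.range ((∏ p ∈ S,
p) / 2 ^ m), B.pr id (Literature.Computability.Complexity.boolPair
(Literature.Computability.Complexity.encodingListNatBool.encode (S.sort (· ≤ ·)))
(Literature.Computability.Complexity.boolPair (Computability.encodeNat (x ^ 2 % ∏ p ∈ S, p))
(Computability.encodeNat ((∏ p ∈ S, p) / 2 ^ m)))) {w | Computability.decodeNat w < (∏ p ∈ S, p) / 2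
^ m ∧ Computability.decodeNat w ^ 2 ≡ x ^ 2 [MOD ∏ p ∈ S, p]}) / ((((∏ p ∈ S, p) / 2 ^ m : ℕ)) : ℝ))
/ (fam.card : ℝ) ≤ 1 - 1 / ((q.eval m : ℕ) : ℝ)`

## Assembly
Deciding theorem (D-0027 §2.1, certified): `theorem closes (hX : PlantedRootHardness) (hW :
PlantedToWorstCase) (hS : WorstCaseToSummit) :
PneNP := hS (hW hX)`. Pure logic on top of two glue supports: PlantedToWorstCase (X -> W) and
WorstCaseToSummit (W -> PneNP) give X -> PneNP;
both arrows use only PROVED tree theorems (RandAlg.pr_ofDet, RandAlg.IsPolyTime.ofDet_holds,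
exists_searchFn_of_NP_subset_P, P_bool_eq_holds /
NP_bool_eq_holds, the CodeFP arithmetic bricks, Chebyshev-type prime counts), so the route's import
cone has NO unproved named fact (rev 2: the
crypto dictionary PlantedToWeakOWF and the import
Literature.Computability.Cryptography.OneWayFunctions were dropped for exactly this reason).
Cruxes #4-#5 and the census supports are informative rungs, not premises of `closes`; the optional
`Assembly` item (X -> PneNP) is the
composition of the two glue supports.

Rationale: WHY THIS LINE. Manders–Adleman's QUADRATIC CONGRUENCES (MandersAdleman1978; GJ [AN1], book:garey1979
p.237) is the one classical NP-complete problem of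
multiplicative number theory, and with the factorisation known its difficulty is exactly a CRT
sign-knapsack; the route bets that planting a
small root below b/2^m over random primes gives an average-case hard problem of one-way-function
strength, and X -> PneNP is two proved tree
facts away (exists_searchFn_of_NP_subset_P, pneNP_shape_of_NP_not_subset_P). What is imported:
subset-sum one-wayness and its density calculus
(ImpagliazzoNaor1996, LagariasOdlyzko1985), noisy-CRT / small-root cryptanalysis as the designated
attack class (BleichenbacherNguyen2000,
Coppersmith1997: provable reach gamma = 1/2 against the planted gamma = 1 - 1/l), and analytic
number theory of Kloosterman fractions and roots of
congruences (DukeFriedlanderIwaniec1997, Hooley1964, DukeFriedlanderIwaniec1995, Toth2000) for the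
census of pseudo-solutions, which is where the
structure "weights diagonal in CRT coordinates" is confronted with equidistribution at scale 2^-m.
Versus the uniform-weight twin with the same
CRT modulus (1D-SIS, BrakerskiVaikuntanathan2015; number balancing, VafaVaikuntanathan2025 =
arXiv:2501.16517), which is worst-case-lattice hard,
our weights are maximally structured — the thesis is that this structure does not help. No prior
route (MetaCplx/Ktlang: K^t; Lattice: GapSVP;
Feige; PlantedClique) uses a number-theoretic candidate; negatives index empty at filing.

RANKED CRUXES. #2 PlantedRootHardness (crux) — the thesis X itself (card item B1, made problem-level
and typed): weak average-case hardness of finding a square root below [difficulty: open-problem]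
(why it might fail: Structured knapsacks sold as random have a bad record (Merkle-Hellman,
Chor-Rivest): weights (b/p)t_p are diagonal in CRT coordinates; a CRT-aware lattice/Coppersmith
variant (BN00, Coppersmith reach gamma=1/2) or BKZ on density-1 knapsacks might solve almost all
instances.) [ImpagliazzoNaor1996, BleichenbacherNguyen2000, Coppersmith1997, LagariasOdlyzko1985,
MandersAdleman1978, Goldreich2001]
#3 TernaryPseudoSolutions (crux) — lattice/meet-in-the-middle blindness at density one, as a theorem
of number theory: for all large m and all but a 1/m fraction [difficulty: L] (why it might fail:
True on average (numerics m<=13 match 2*1.5^m), but 'all but 1/m of instances' needs pair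
correlations of x*E_z/b at heights up to 2^m >> p ~ m^3, i.e. large-deviation equidistribution of
Kloosterman fractions inv(b/p)/p far beyond the DFI bilinear range; a conspiracy could cluster the
counts.) [DukeFriedlanderIwaniec1997, Hooley1964, DukeFriedlanderIwaniec1995, Toth2000,
BrakerskiVaikuntanathan2015, VafaVaikuntanathan2025]
#4 SqfreeQCNPHard (crux) — the worst-case anchor: QUADRATIC CONGRUENCES restricted to squarefree
moduli presented by their prime factorisation [difficulty: L] (why it might fail: MA78's device
needs sign-channel moduli q_j > 2(n+1)M with M exponential: prime powers (MA78) or primes of ~n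
bits, which a deterministic reduction cannot currently find (Polymath4-type obstacle); JKL22 Thm 2
claims it but treats composite blocks as prime powers (gap). May need a new encoding.)
[MandersAdleman1978, JansenKleinLassota2022, arXiv:2008.12928,
book:garey1979-computers-intractability-guide-theory-np-completeness p.237]
#5 PlantedRootNegligible (crux) — the strong form of X: every PPT solver has success probability <=
1/m^k on D_m for every k, eventually (negligible success; [deps: PlantedRootHardness] [difficulty:
open-problem] (why it might fail: Fails if some PPT attack keeps 1/poly success: BKZ with poly block
size on density-1 CRT knapsacks for a 1/poly mass of (S,x), or an easy 1/poly sub-family (many tiny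
t_p, x < b^(1/2+eps)); the sub-families we could name have mass 2^-Omega(m), but nothing is proved.)
[ImpagliazzoNaor1996, BleichenbacherNguyen2000, Coppersmith1997, VafaVaikuntanathan2025,
Goldreich2001]
#9 SqfreeRootSearchHard (support) — worst-case shadow W: no FP function, given (S strictly
increasing primes, a, c), returns z <= c with z^2 = a mod prod S whenever [difficulty: open-problem]
[MandersAdleman1978, Goldreich2001]
#9 PlantedToWorstCase (support) — glue #2 -> W: a worst-case FP solver g is a coin-free PPT solver
(RandAlg.ofDet g, pr_ofDet, IsPolyTime.ofDet_holds) with success 1 on every planted instance once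
the bound is made strict (call g on (S, a, c-1): x < c so a root <= c-1 exists; or count the <= 2^m
inputs x < c with x^2 = c^2 mod b against c >= 2^(m(3k+1))); fam is non-empty for all large m (>= m
primes in [2^(3k+2), 2^(3k+3)), k = log2 m, e.g. via tendsto_card_primes_Ico_mul_log_div)
[difficulty: M] [Goldreich2001, Literature.Computability.Complexity.RandAlg.IsPolyTime.ofDet]
#9 WorstCaseToSummit (support) — glue W -> PneNP: if not PneNP then NP subset P (P_bool_eq_holds /
NP_bool_eq_holds of ClayProblemProofs, as in pneNP_shape_of_NP_not_subset_P — provers should use the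
ClayProblemProofs bridges directly and NOT import Cryptography.OneWayFunctionsPneNP, which drags the
unproved OWF existence facts into the cone), then exists_searchFn_of_NP_subset_P on the P-relation
'z <= c and z^2 = a mod prod S' (membership in P via the CodeFP bricks natMod/natMul/list fold)
[difficulty: M] [AroraBarakCC2009 Thm 2.18, Goldreich2001 §2.7.4 Ex. 2,
Literature.Computability.Complexity.exists_searchFn_of_NP_subset_P]
#9 ExpectedPseudoSolutions (support) — expectation version of #3 (provable now by Erdős–Turán over x
< c plus the product formula [difficulty: M] [DukeFriedlanderIwaniec1997, Hooley1964]

TWO-LAYER PLAN. Foreseen (not filed): TernaryPseudoSolutions <= ExpectedPseudoSolutions ->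
PairCorrelationBound (second moment of the count over x < c,
degenerate pairs only z' = +-z below height p/2) -> TernaryPseudoSolutions (Chebyshev);
SqfreeQCNPHard <= SqfreeQCNPHardRandomized (MA78 with
random ~n-bit primes per sign channel) -> DeterministicLargePrimes (as an explicit hypothesis) ->
SqfreeQCNPHard, or a new encoding;
PlantedRootHardness earns evidence rungs as supports (noisy-CRT lattice fails above gamma = 1/2;
low-degree/SQ failure) rather than a split.

KILL CRITERIA. A poly-time algorithm finding roots below b^(1-1/l) modulo squarefree b with known
factors (refutes #2, #5 and W: close refuted:PlantedRootHardness);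
kit evidence that BKZ solves CRT-structured density-1 knapsacks markedly more often than
random-weight twins as m grows (suspect-false on #2 ->
pivot parameters (c = b/2^(2m)?) or close); #4 refuted in the strong sense 'the squarefree slice is
in P' kills everything; #4 merely
unprovable-deterministically does not (pivot #4 to the randomized statement). #3 refuted => the
structure IS visible to lattices at density one:
close. Proved elsewhere: OWFExist (MetaCplx) does not moot X but makes the assembly redundant.

NOT DECOMPOSED YET. No restricted-model lower bounds (BKZ block-size, low-degree, statistical-query)
are filed: they are evidence, attach as supports under #2 when
someone has a typed class. No parameter variants (other c, prime sizes, prime powers instead of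
primes). No search-to-decision or amplification
items (Yao is in the tree). The Hooley/DFI statistics of #(roots < c) under the NULL distribution
(random QR a) are not filed — elementary here
because x ranges over an interval longer than every proper sub-product of primes that matters. The
crypto dictionary X -> WeakOWFExist (Goldreich2001 Def. 2.2.2; formerly support
PlantedToWeakOWF, dropped at rev 2) is deliberately NOT an item: it is not a premise of `closes` and
its import
(Literature.Computability.Cryptography.OneWayFunctions) carried the four unproved existence facts
OWFExist / IOOWFExist / WeakOWFExist /
NonuniformOWFExist into the route's cone; it may be proved as a remark in a Theorems file once #2
closes. needs-fact: none.

CHEAPEST FALSIFIER. (i) Lookup, done: is the squarefree slice already NP-hard in print? GJ AN1 /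
MA78 use prime powers; JKL22 Thm 2 claims it with a gapped proof
(pp. 7-8 of arXiv:2008.12928) — #4 stands as open. (ii) Numerics, done locally (m = 8..13):
pseudo-solution counts 47-61 (m=8, predicted 51),
97-137 (m=10, 115), 251-281 (m=12, 260), 409-427 (m=13, 389) — #3's threshold (4/3)^m is far below.
(iii) To run first by a refuter (kit):
BKZ-20/40 on the Schnorr–Euchner/CJLOSS embedding of planted CRT instances vs random-weight twins
with the same top-m-bit target, m = 40..120,
20 instances each; a success gap widening with m in favour of CRT structure is suspect-false
evidence on #2/#5.

NUMBERS. density: c = floor(b/2^m) => E#(roots < c) = 2^m c/b ~ 1 (+ planted pair); prime bit-length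
l = 3 floor(log2 m) + 3 (p in (m^3/2, 8 m^3]);
planted root height gamma = log c / log b = 1 - 1/l vs Coppersmith/BN00 provable reach gamma = 1/2
(Coppersmith1997); brute force 2^m =
2^O(n/log n) in input length n ~ 2 m l; generic knapsack algorithms 2^(0.3m)-type; pseudo-solution
count ~ 2 (3/2)^m (numerics above);
Karmarkar–Karp reaches discrepancy 2^-O(log^2 m) on random reals and VafaVaikuntanathan2025 show
2^-(log m)^(3+eps) is lattice-hard — our target
discrepancy is 2^-m with structured rationals.

DEFINITION REQUESTS. QUADCONG (GJ [AN1]) as a `Language Bool` in Literature/Computability/Complexity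
(KarpProblems style) with the named fact
isNPComplete_QUADCONG [MandersAdleman1978; GJ AN1 incl. 'factorisation given'] — filed after open
with --for SqfreeQCNPHard; not load-bearing.

Novelty: Searches (2026-08-15): lit search (searchd down most of the session; s2: "number partitioning
lattices Vafa Vaikuntanathan" 1 hit), lit galaxy
search "NP-complete decision problems for binary quadratics" --star all (10 panama hits: GJ, Kučera,
IPCO 2021 volume -> JKL22), lit read
arXiv:2008.12928 (JKL22, full), arXiv:2501.16517 (VV25, full), book:garey1979 p.237; lit frontier
PneNP --since 2022 / lit bridges PneNP
--cross any (no number-theoretic OWF neighbours); lean search (RandAlg, SIS.successProb template,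
IsNPHard, exists_searchFn_of_NP_subset_P);
plus the card's two novelty audits (MA78, IN96, LPS10, BN00, Boneh, GRS, Hooley, DFI, Cochrane).
Nearest prior art found: MandersAdleman1978 (NP-completeness; the CRT/knapsack reading is their
proof device); JansenKleinLassota2022 (names the
two-candidate CRT problem 'MRD', claims squarefree-odd-part NP-hardness — gapped);
ImpagliazzoNaor1996 (subset-sum OWF, density regimes);
BrakerskiVaikuntanathan2015 1D-SIS and VafaVaikuntanathan2025 (uniform-weight modular/real balancing
is worst-case-lattice hard);
BleichenbacherNguyen2000 / Coppersmith1997 (attacks, gamma <= 1/2); DukeFriedlanderIwaniec1997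
(Kloosterman fractions), Hooley1964 /
DukeFriedlanderIwaniec1995 / Toth2000 (roots of congruences).
Delta: nobody has posed the diagonal-CRT-weight knapsack from a planted small square root as an
average-case hardness thesis; the route types it
to P != NP with a proved assembly cone, isolates the pseudo-solution census as the number-t  [refs: 2008.12928, 2501.16517, book:garey1979, MandersAdleman1978, JansenKleinLassota2022, ImpagliazzoNaor1996, BrakerskiVaikuntanathan2015, VafaVaikuntanathan2025, BleichenbacherNguyen2000, Coppersmith1997, DukeFriedlanderIwaniec1997, Hooley1964, DukeFriedlanderIwaniec1995, Toth2000]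

Barriers (technique_class: number-theoretic-planted-knapsack, exponential-sums): - technique_class: number-theoretic-planted-knapsack, exponential-sums
- Literature.Barriers.PneNP.NPHardnessToOneWayFunctions: not triggered — the route never derives X
from NP-hardness; #4 is a worst-case anchor and W <-> PneNP calibration only; a non-adaptive
black-box worst-to-average reduction for this problem would put coNP in AM and is not attempted (no
random self-reduction in x is known: a -> a u^2 destroys smallness).
- Literature.Barriers.PneNP.LowDegreeCounterexamples: heeded — #3 is a statement about the
attack-relevant object (short vectors of the knapsack lattice / meet-in-the-middle lists), not
'low-degree hard => hard'; no inference from k-wise independence of the weights (which is trivial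
here by CRT) is made.
- Literature.Barriers.PneNP.LatticeGapCoNP: cautionary only — no gap/promise version is filed; if
one is (root <= c vs none <= g c), g must be checked against coNP certificates for the CRT lattice.
- Literature.Barriers.PneNP.Relativization: it does not evade it; X, #5 and W are hardness
statements for explicit problems whose proofs must be non-relativizing; the bet is the standard
cryptographic one (candidate + provable census + failed cryptanalysis), made for a candidate whose
structure is theorem-rich.
- Literature.Barriers.PneNP.NaturalProofs: applies to any circuit-lower-bound proof of X and is
self-undermining in the usual way (X gives weak OWF => PRFs => no natural proofs); not evaded.
- Literature.Barriers.PneNP.Algebrization: applies by inheri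

History (route lifecycle, newest last):
- 2026-08-15T16:11:28Z · rev 2: dropped PlantedToWeakOWF — route-repair (cone guardrail + glue.missing): (a) re-routed around the 4 unproved cone facts — dropped support PlantedToWeakOWF (crypto dictionary X -> WeakOWFE (planner-rbadge-PneNP-Kloosterman-edeff85c-g2-0)
- 2026-08-22T18:54:24Z · DORMANT — reconciler: no traction for 5.6 d (last activity item-evidence-added at 2026-08-17T04:27:20Z); parked, not closed — `ledger route dormant route-PneNP-Kloosterma (operator:999:1646066)

sub-problem: PneNP · status: dormant · opened planner-plancard-PneNP-PneNP-kloosterman-knap-bc273fa8-0 2026-08-15T11:05:30Z · rev 2 · ledger route-PneNP-Kloosterman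
GENERATED by the gate from the ledger (D-0016/17). Provers cite these decls: `theorem foo : Summit.PneNP.PneNP.Theses.Kloosterman.<Decl> := …` in Summits/PneNP/PneNP/Theorems/<Name>.lean.
-/

namespace Summit.PneNP.PneNP.Theses.Kloosterman

open scoped BigOperators Topology Manifold Classical MeasureTheory ProbabilityTheory Matrix InnerProductSpace ComplexConjugate ContinuousMap
open Filter Set Function TopologicalSpace MeasureTheory

attribute [summit_statement] _root_.PneNP

open Literature.PNP

/-- item stmt-PneNP-2573 · crux · rank 2 · open · by planner
why it might fail: CRT-diagonal weights (w_p/b = t_p/p, p ~ m^3) give a 2-candidate noisy-CRT instance: GRS/Boneh/BN00/Coppersmith lattices provably reach only b^(1/2), but a CRT-aware density-1 BKZ heuristic or an easy (1-o(1))-mass sub-ensemble would beat 1-1/q; structured knapsacks break (Shamir, Vaudenay).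
sources: ImpagliazzoNaor1996, BleichenbacherNguyen2000, Coppersmith1997, doi:10.1109/18.850672, doi:10.1145/335305.335337, doi:10.1109/tit.1984.1056964
[crux] the thesis X itself (card item B1, made problem-level and typed): weak average-case hardness
of finding a square root below [difficulty: open-problem] -/
@[route_item "route-PneNP-Kloosterman", crux]
def PlantedRootHardness : Prop :=
  ∃ q : Polynomial ℕ, (∀ n, 0 < q.eval n) ∧ ∀ B : Literature.Computability.Complexity.RandAlg (List Bool) (List Bool), B.IsPolyTime (id : List Bool → List Bool) (id : List Bool → List Bool) → ∀ᶠ m : ℕ in Filter.atTop, let fam : Finset (Finset ℕ) := ((Finset.Ico (2 ^ (3 * Nat.log 2 m + 2)) (2 ^ (3 * Nat.log 2 m + 3))).filter Nat.Prime).powersetCard m; (∑ S ∈ fam, (∑ x ∈ Finset.range ((∏ p ∈ S, p) / 2 ^ m), B.pr id (Literature.Computability.Complexity.boolPair (Literature.Computability.Complexity.encodingListNatBool.encode (S.sort (· ≤ ·))) (Literature.Computability.Complexity.boolPair (Computability.encodeNat (x ^ 2 % ∏ p ∈ S, p)) (Computability.encodeNat ((∏ p ∈ S, p) / 2 ^ m))))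 {w | Computability.decodeNat w < (∏ p ∈ S, p) / 2 ^ m ∧ Computability.decodeNat w ^ 2 ≡ x ^ 2 [MOD ∏ p ∈ S, p]}) / ((((∏ p ∈ S, p) / 2 ^ m : ℕ)) : ℝ)) / (fam.card : ℝ) ≤ 1 - 1 / ((q.eval m : ℕ) : ℝ)

/-- item stmt-PneNP-2575 · crux · rank 4 · open · by planner
why it might fail: IsNPHard = deterministic Karp; MA78 sign channels need moduli with exactly 2 roots of theta^2, size > 2(n+1)max: odd prime powers (non-squarefree) or n-bit primes, no deterministic construction known (Tao-Croot-Helfgott); composite blocks admit mixed splits (gap in JKL22 Thm 2, p.7; keeps 2^4 too).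
sources: MandersAdleman1978, arXiv:2008.12928, book:garey1979-computers-intractability-guide-theory-np-completeness p.237, doi:10.1090/s0025-5718-2011-02542-1, Literature.Computability.Complexity.IsNPHard
[crux] the worst-case anchor: QUADRATIC CONGRUENCES restricted to squarefree moduli presented by
their prime factorisation [difficulty: L] -/
@[route_item "route-PneNP-Kloosterman"]
def SqfreeQCNPHard : Prop :=
  Literature.Computability.Complexity.IsNPHard {w : List Bool | ∃ (S : List ℕ) (a c : ℕ), w = Literature.Computability.Complexity.boolPair (Literature.Computability.Complexity.encodingListNatBool.encode S) (Literature.Computability.Complexity.boolPair (Computability.encodeNat a) (Computability.encodeNat c)) ∧ S.Pairwise (· < ·) ∧ (∀ p ∈ S, Nat.Prime p) ∧ ∃ z : ℕ, z ≤ c ∧ z ^ 2 ≡ a [MOD S.prod]}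

/-- item stmt-PneNP-2576 · crux · rank 5 · open · by planner
why it might fail: Negligible success on the same D_m doesn't follow from #2 (Yao amplification changes the function): any PPT attack with 1/poly mass kills it, e.g. small-block BKZ on the CJLOSS lattice winning on 1/poly of (S,x), or a 1/poly-mass easy sub-family; known easy families have mass 2^-Omega(m), unproved.
sources: Goldreich2001, ImpagliazzoNaor1996, BleichenbacherNguyen2000, Coppersmith1997, arXiv:2501.16517, LagariasOdlyzko1985
[crux] the strong form of X: every PPT solver has success probability <= 1/m^k on D_m for every k,
eventually (negligible success; [deps: PlantedRootHardness] [difficulty: open-problem] -/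
@[route_item "route-PneNP-Kloosterman"]
def PlantedRootNegligible : Prop :=
  ∀ B : Literature.Computability.Complexity.RandAlg (List Bool) (List Bool), B.IsPolyTime (id : List Bool → List Bool) (id : List Bool → List Bool) → ∀ k : ℕ, ∀ᶠ m : ℕ in Filter.atTop, let fam : Finset (Finset ℕ) := ((Finset.Ico (2 ^ (3 * Nat.log 2 m + 2)) (2 ^ (3 * Nat.log 2 m + 3))).filter Nat.Prime).powersetCard m; (∑ S ∈ fam, (∑ x ∈ Finset.range ((∏ p ∈ S, p) / 2 ^ m), B.pr id (Literature.Computability.Complexity.boolPair (Literature.Computability.Complexity.encodingListNatBool.encode (S.sort (· ≤ ·))) (Literature.Computability.Complexity.boolPair (Computability.encodeNat (x ^ 2 % ∏ p ∈ S, p)) (Computability.encodeNat ((∏ p ∈ S, p) / 2 ^ m)))) {w | Computability.decodeNat w < (∏ p ∈ S, p) / 2 ^ m ∧ Computability.decodeNat w ^ 2 ≡ x ^ 2 [MOD ∏ p ∈ S, p]}) / ((((∏ p ∈ S, p) / 2 ^ m : ℕ)) : ℝ)) / (fam.card : ℝ) ≤ 1 / (m : ℝ) ^ k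

/-- item stmt-PneNP-2574 · support · rank 3 · open · by planner
why it might fail: True on average (numerics m<=13 match 2*1.5^m), but 'all but 1/m of instances' needs pair correlations of x*E_z/b at heights up to 2^m >> p ~ m^3, i.e. large-deviation equidistribution of Kloosterman fractions inv(b/p)/p far beyond the DFI bilinear range; a conspiracy could cluster the counts.
sources: KowalskiSoundararajan2021, DukeFriedlanderIwaniec1997, Hooley1964
[crux] lattice/meet-in-the-middle blindness at density one, as a theorem of number theory: for all
large m and all but a 1/m fraction [difficulty: L] -/
@[route_item "route-PneNP-Kloosterman"]
def TernaryPseudoSolutions : Prop :=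
  ∀ᶠ m : ℕ in Filter.atTop, let fam : Finset (Finset ℕ) := ((Finset.Ico (2 ^ (3 * Nat.log 2 m + 2)) (2 ^ (3 * Nat.log 2 m + 3))).filter Nat.Prime).powersetCard m; let inst : Finset (Σ _ : Finset ℕ, ℕ) := fam.sigma fun S => Finset.range ((∏ p ∈ S, p) / 2 ^ m); ((inst.filter fun Sx : (Σ _ : Finset ℕ, ℕ) => ((Finset.univ.filter fun z : ↥(Sx.1) → SignType => ∃ y : ℤ, |y| * 2 ^ m < ((∏ p ∈ Sx.1, p : ℕ) : ℤ) ∧ ∀ p : ↥(Sx.1), ((p : ℕ) : ℤ) ∣ y - (Sx.2 : ℤ) * (z p : ℤ)).card : ℝ) < (4 / 3 : ℝ) ^ m).card : ℝ) ≤ (inst.card : ℝ) / m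

/-- item stmt-PneNP-2577 · support · rank 9 · open · by planner
sources: MandersAdleman1978, Goldreich2001
[support] worst-case shadow W: no FP function, given (S strictly increasing primes, a, c), returns z
<= c with z^2 = a mod prod S whenever [difficulty: open-problem] -/
@[route_item "route-PneNP-Kloosterman"]
def SqfreeRootSearchHard : Prop :=
  ¬ ∃ g ∈ Literature.Computability.Complexity.FP, ∀ (S : List ℕ) (a c : ℕ), S.Pairwise (· < ·) → (∀ p ∈ S, Nat.Prime p) → (∃ z : ℕ, z ≤ c ∧ z ^ 2 ≡ a [MOD S.prod]) → Computability.decodeNat (g (Literature.Computability.Complexity.boolPair (Literature.Computability.Complexity.encodingListNatBool.encode S) (Literature.Computability.Complexity.boolPair (Computability.encodeNat a) (Computability.encodeNat c)))) ≤ c ∧ Computability.decodeNat (g (Literature.Computability.Complexity.boolPair (Literature.Computability.Complexity.encodingListNatBool.encode S) (Literature.Computability.Complexity.boolPair (Computability.encodeNat a) (Computability.encodeNat c)))) ^ 2 ≡ a [MOD S.prod]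

/-- item stmt-PneNP-2578 · support · rank 9 · closed · proved by Summit.PneNP.PneNP.Theorems.kloosterman_plantedToWorstCase_proof @ 4323baec17ef (prover) · by planner
sources: Goldreich2001, Literature.Computability.Complexity.RandAlg.IsPolyTime.ofDet
[support] glue #2 -> W: a worst-case FP solver g is a coin-free PPT solver (RandAlg.ofDet g,
IsPolyTime.ofDet_holds) with success 1 on [difficulty: provable-now] -/
@[route_item "route-PneNP-Kloosterman", crux]
def PlantedToWorstCase : Prop :=
  PlantedRootHardness → SqfreeRootSearchHard

/-- item stmt-PneNP-2579 · support · rank 9 · closed · proved by Summit.PneNP.PneNP.Theorems.kloosterman_worstCaseToSummit_proof @ 69a76d8487bd (prover) · by planner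
sources: AroraBarakCC2009 Thm 2.18, Goldreich2001 §2.7.4 Ex. 2, Literature.Computability.Complexity.exists_searchFn_of_NP_subset_P
[support] glue W -> PneNP: if not PneNP then NP subset P (pneNP_shape_of_NP_not_subset_P, proved),
and exists_searchFn_of_NP_subset_P [difficulty: M] -/
@[route_item "route-PneNP-Kloosterman", crux]
def WorstCaseToSummit : Prop :=
  SqfreeRootSearchHard → PneNP

/-- item stmt-PneNP-2581 · support · rank 9 · open · by planner
sources: DukeFriedlanderIwaniec1997, Hooley1964
[support] expectation version of #3 (provable now by Erdős–Turán over x < c plus the product formula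
[difficulty: M] -/
@[route_item "route-PneNP-Kloosterman"]
def ExpectedPseudoSolutions : Prop :=
  ∀ᶠ m : ℕ in Filter.atTop, let fam : Finset (Finset ℕ) := ((Finset.Ico (2 ^ (3 * Nat.log 2 m + 2)) (2 ^ (3 * Nat.log 2 m + 3))).filter Nat.Prime).powersetCard m; let inst : Finset (Σ _ : Finset ℕ, ℕ) := fam.sigma fun S => Finset.range ((∏ p ∈ S, p) / 2 ^ m); (4 / 3 : ℝ) ^ m ≤ (∑ Sx ∈ inst, ((Finset.univ.filter fun z : ↥(Sx.1) → SignType => ∃ y : ℤ, |y| * 2 ^ m < ((∏ p ∈ Sx.1, p : ℕ) : ℤ) ∧ ∀ p : ↥(Sx.1), ((p : ℕ) : ℤ) ∣ y - (Sx.2 : ℤ) * (z p : ℤ)).card : ℝ)) / (inst.card : ℝ)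

/-- item stmt-PneNP-2582 · assembly · rank 1 · closed · proved by Summit.PneNP.PneNP.Theorems.kloosterman_assembly_proof @ 1d966fd8e1ba (prover) · by planner
sources: Goldreich2001, AroraBarakCC2009
[assembly] PlantedRootHardness -> PneNP -/
@[route_item "route-PneNP-Kloosterman"]
def Assembly : Prop :=
  PlantedRootHardness → PneNP

/-! D-0027 §2.1 — DECIDING THEOREM (planner-authored via `route open/edit --closes-file`; by planner-rbadge-PneNP-Kloosterman-edeff85c-g2-0 2026-08-15T16:11:28Z):
its hypotheses are this route's items and its conclusion the sub-problem Statement (glue_lint), and it elaborates with this file. -/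

@[closes "route-PneNP-Kloosterman"] theorem closes (hX : PlantedRootHardness) (hW : PlantedToWorstCase) (hS : WorstCaseToSummit) : PneNP :=
  hS (hW hX)

end Summit.PneNP.PneNP.Theses.Kloosterman
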